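import Summits.KontsevichZagierPeriods.KontsevichZagierPeriods.Theorems.RootDecompOrderCutEdges

/-!
# decomp-kz · lens 5 «finite/base range + asymptotic regime + bridge» · generation 13
# NODE g13 — FINITE STAGES AND THE `𝔭`-ADIC CUT  (`𝔭 := ker v`, `v = evalP : P → ℝ`, `P = KZ.FormalPeriodRing`)

Standalone lens file (the g12 monolith `g12/PureDefect.lean`, 501 226 B, stays the record of §§0–15; this file
imports only the TREE: the landed lens theorems `Theorems.RootDecompOrderCutEdges` ← `RootDecompPureDefectProperCone(P1)`
and the born route files `Theses.RootDecompOrderCut` (O: items 32161 `DefectNegligible`, 31891 `ProperCone`, 3929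
`ReducedPeriodRing`) and `Theses.RootDecompPureDefect` (E″: 27508 `PiFlatDefect`, 27509 `PiConnected`)).

THE LENS TRIAD, LITERALLY, ON THE RING `P`:
* FINITE RANGE  = the finitely generated (hence Noetherian, Hilbert) STAGES `A = ℤ[F] ⊆ P`, `F ⊂ P` finite, each with
  its defect ideal `𝔭_A = 𝔭 ∩ A`;
* ASYMPTOTIC REGIME = the `𝔭_A`-adic topology of a stage: the ADIC KERNEL `κ(A) = ⋂ₙ 𝔭_Aⁿ` (what dies in the completion);
* BRIDGE = KRULL'S INTERSECTION THEOREM (Artin–Rees, Mathlib `Ideal.mem_iInf_smul_pow_eq_bot_iff`): at a Noetherian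
  stage, `x ∈ κ(A) ⟺ ∃ i ∈ 𝔭_A, i·x = x` — adic death is witnessed by ONE multiplier of value one.

PIECES (all `Prop`s over the tree's `FormalPeriodRing`, `evalP`):
* `AdicDefect`     — every defect is fixed by a defect: `v x = 0 ⟹ ∃ i, v i = 0 ∧ i·x = x`
                      ⟺ every defect dies `𝔭`-adically in some finite stage (`adicDefect_iff_stages`)
                      ⟺ KZ's conjecture UP TO A MULTIPLIER OF VALUE ONE / OF NON-ZERO RATIONAL VALUE / OF NON-ZERO
                        ALGEBRAIC VALUE (`adicDefect_iff_torsionOne / _iff_ratTorsion / _iff_algTorsion`);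
* `AdicSeparated`  — `1 + 𝔭` acts injectively: `v i = 0 ⟹ i·x = x ⟹ x = 0`
                      ⟺ EVERY finite stage is `𝔭`-adically separated, `κ(A) = 0` (`adicSeparated_iff_stages`)
                      ⟺ classes of value one / of non-zero rational value / of non-zero algebraic value are
                        non-zero-divisors (`adicSeparated_iff_cancelOne / _iff_ratCancellation / _iff_algCancellation`);
* `LocTriv`        — KZ up to a multiplier of non-zero value (`𝔭·P_𝔭 = 0`), the torsion half of the TOP member of the
                     census σ-family EQ11 (recorded for comparison, not claimed);
* `Cancellation`   — SoloBlind's (C) read on `P` (comparison piece, census R1).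

THE CUT (deciding theorem of this node): `closes_adic : AdicDefect → AdicSeparated → KontsevichZagierPeriods`,
EXACT (`summit_iff_adic`), i.e. the σ-family member at the multiplier set `M = 1 + 𝔭 = v⁻¹(1)` — by census doctrine
(EQ11) admissible as a node only because (a) BOTH halves are WEAKER with kernel evidence (`ℝ × ℝ ⊨ AdicDefect ∧ ¬S`,
`ℝ[X] ⊨ AdicSeparated ∧ ¬S`, §7) and (b) both halves have INDEPENDENT FEEDERS and a DECISION FORM at finite stages:
`FlatDefect ⟹ AdicDefect`, `Cancellation ⟹ AdicSeparated ⟸ KrullSeparated(P)`, `ProperCone ∧ ReducedPeriodRing ⟹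
AdicSeparated`; and `AdicSeparated` is the WEAKEST right half on record (strictly below Cancellation, below Krull(P),
blind to `ϖ`-torsion phantoms: `𝔑 ⊨ 0541 ∧ AdicSeparated ∧ ¬0540`), while ALL of the `π`-division difficulty (0540)
sits in the left half `AdicDefect` (no Γ-rung: in a one-pair stage `AdicDefect(δ) ⟺ δ ∈ δ²A`, §6/§7 model `𝔛`).

THE EXCHANGE LATTICE (kernel, `exchange_lattice`): torsion halves `FlatDefect ⟹ AdicDefect ⟹ LocTriv ⟹ DefectNegligible`
(32161; NEW FEEDER of route O's deciding crux: `defectNegligible_of_locTriv`, content = `posCertificate`), `PiFlatDefect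
(27508) ⟹ LocTriv`, `PiPowerDefect (0541-form) ⟹ LocTriv`, `AdicDefect ⟹ KernelIdempotent`; cancellation halves
`ProperCone ∧ Reduced ⟹ Cancellation ⟹ AdicSeparated ⟹ Connected`, `KrullSeparated ⟹ AdicSeparated`; exact diagonals
`S ⟺ AdicDefect ∧ AdicSeparated ⟺ LocTriv ∧ Cancellation ⟺ DN ∧ PC ∧ Red`; the MIXED weak pair is NOT exact:
`𝔛 ⊨ LocTriv ∧ AdicSeparated ∧ ¬S` (free index-two stage).

UNCONDITIONAL TRUE-RING THEOREMS: `sq_mem_supp_of_torsionOne` (a class killed by a value-one multiplier has its square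
in `T ∩ −T`), hence `ProperCone ⟹` adic kernels of all finite stages are square-zero (`sq_eq_zero_of_adicKernel_of_properCone`);
the BASE STAGE `ℤ[ϖ]` meets `𝔭` trivially (`defect_base_stage`, Lindemann via the tree's `eval₂_pi_ne_zero`).

All statements sorry-free; standard axioms.
-/

/-! # `RootDecompOrderCutAdicStagesP1` — part 1/5 of the mechanical ≤350-line split of `src.lean`
(split by the decomp-kz census seat for landing; mathematics unchanged). -/

noncomputable section

open Literature.NumberTheory.Transcendental Literature.NumberTheory.Transcendental.KZ
open Summit.KontsevichZagierPeriods.KontsevichZagierPeriods.Theses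
open Summit.KontsevichZagierPeriods.RootDecompPureDefect
open Summit.KontsevichZagierPeriods.RootDecompOrderCut
open Polynomial

namespace Summit.KontsevichZagierPeriods.RootDecompAdicStages

/-! ## 1. Interface: the pieces over an arbitrary `v : R →+* ℝ`, and the generic edges -/

namespace Iface

variable {R : Type*} [CommRing R] (v : R →+* ℝ)

/-- `S` on the interface: `ker v = 0`. -/
def SI : Prop := ∀ x : R, v x = 0 → x = 0

/-- `LocTriv`: every defect is killed by a class of non-zero value. -/
def LocTrivI : Prop := ∀ x : R, v x = 0 → ∃ s : R, v s ≠ 0 ∧ s * x = 0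

/-- `AdicDefect`: every defect is fixed by a defect. -/
def AdicDefectI : Prop := ∀ x : R, v x = 0 → ∃ i : R, v i = 0 ∧ i * x = x

/-- `AdicSeparated`: `1 + ker v` acts injectively. -/
def AdicSeparatedI : Prop := ∀ x i : R, v i = 0 → i * x = x → x = 0

/-- `Cancellation`: classes of non-zero value are non-zero-divisors. -/
def CancellationI : Prop := ∀ g x : R, v g ≠ 0 → g * x = 0 → x = 0

/-- `Connected`: no idempotent of value `0` except `0`. -/
def ConnectedI : Prop := ∀ e : R, IsIdempotentElem e → v e = 0 → e = 0

/-- `FlatDefect`: the defect ideal is pure, `x ∈ x²R`. -/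
def FlatDefectI : Prop := ∀ x : R, v x = 0 → ∃ h : R, x = x * x * h

/-- `KernelIdempotent`: `ker v ⊆ (ker v)²`. -/
def KernelIdempotentI : Prop := ∀ x : R, v x = 0 → x ∈ RingHom.ker v * RingHom.ker v

/-- `KrullSeparated`: `⋂ₙ (ker v)ⁿ = 0` in `R` itself. -/
def KrullSeparatedI : Prop := ∀ x : R, (∀ n : ℕ, x ∈ RingHom.ker v ^ n) → x = 0

/-- `PiPowerDefect` (0541 read on the interface): every defect is `ϖ`-power torsion. -/
def PiPowerDefectI (ϖ : R) : Prop := ∀ x : R, v x = 0 → ∃ N : ℕ, ϖ ^ N * x = 0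

/-- `PiFlatDefect` (27508 on the interface). -/
def PiFlatDefectI (ϖ : R) : Prop := ∀ x : R, v x = 0 → ∃ (k : ℕ) (h : R), ϖ ^ k * x = x * x * h

/-- `PiConnected` (27509 on the interface). -/
def PiConnectedI (ϖ : R) : Prop :=
  ∀ f : R, (∃ k : ℕ, f * f = ϖ ^ k * f) → v f = 0 → ∃ m : ℕ, ϖ ^ m * f = 0

variable {v}

/-- `FlatDefect ⟹ AdicDefect` (`i = x·h`). -/
theorem adicDefect_of_flat (h : FlatDefectI v) : AdicDefectI v := fun x hx => by
  obtain ⟨k, hk⟩ := h x hx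
  refine ⟨x * k, by rw [map_mul, hx, zero_mul], ?_⟩
  rw [mul_comm (x * k) x, ← mul_assoc]; exact hk.symm

/-- `AdicDefect ⟹ LocTriv` (`s = 1 − i`, value `1`). -/
theorem locTriv_of_adicDefect (h : AdicDefectI v) : LocTrivI v := fun x hx => by
  obtain ⟨i, hi, hix⟩ := h x hx
  refine ⟨1 - i, ?_, ?_⟩
  · rw [map_sub, map_one, hi, sub_zero]; exact one_ne_zero
  · rw [sub_mul, one_mul, hix, sub_self]

/-- `PiPowerDefect ⟹ LocTriv` when `v ϖ ≠ 0`. -/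
theorem locTriv_of_piPower {ϖ : R} (hϖ : v ϖ ≠ 0) (h : PiPowerDefectI v ϖ) : LocTrivI v := fun x hx => by
  obtain ⟨N, hN⟩ := h x hx
  exact ⟨ϖ ^ N, by rw [map_pow]; exact pow_ne_zero N hϖ, hN⟩

/-- `PiFlatDefect ⟹ LocTriv` when `v ϖ ≠ 0` (`s = ϖᵏ − x·h`, value `(v ϖ)ᵏ`). -/
theorem locTriv_of_piFlat {ϖ : R} (hϖ : v ϖ ≠ 0) (h : PiFlatDefectI v ϖ) : LocTrivI v := fun x hx => by
  obtain ⟨k, c, hk⟩ := h x hx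
  refine ⟨ϖ ^ k - x * c, ?_, ?_⟩
  · rw [map_sub, map_mul, hx, zero_mul, sub_zero, map_pow]; exact pow_ne_zero k hϖ
  · rw [sub_mul, hk]; ring

/-- `Cancellation ⟹ AdicSeparated` (`1 − i` has value `1`). -/
theorem adicSeparated_of_cancellation (h : CancellationI v) : AdicSeparatedI v := fun x i hi hix =>
  h (1 - i) x (by rw [map_sub, map_one, hi, sub_zero]; exact one_ne_zero)
    (by rw [sub_mul, one_mul, hix, sub_self])

/-- `i·x = x ⟹ iⁿ·x = x`. -/
theorem pow_mul_eq_of_fix {x i : R} (hix : i * x = x) (n : ℕ) : i ^ n * x = x := by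
  induction n with
  | zero => rw [pow_zero, one_mul]
  | succ n ih => rw [pow_succ, mul_assoc, hix, ih]

/-- `KrullSeparated ⟹ AdicSeparated` (`x = iⁿx ∈ 𝔭ⁿ` for all `n`). -/
theorem adicSeparated_of_krull (h : KrullSeparatedI v) : AdicSeparatedI v := fun x i hi hix =>
  h x fun n => by
    rw [← pow_mul_eq_of_fix hix n]
    exact Ideal.mul_mem_right _ _ (Ideal.pow_mem_pow ((RingHom.mem_ker).mpr hi) n)

/-- `AdicSeparated ⟹ Connected` (`e·e = e`). -/
theorem connected_of_adicSeparated (h : AdicSeparatedI v) : ConnectedI v := fun e he hve => h e e hve he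

/-- `AdicSeparated` kills every FLAT defect (`i = x·h`). -/
theorem flat_defect_eq_zero_of_adicSeparated (h : AdicSeparatedI v) (x c : R) (hx : v x = 0)
    (hc : x = x * x * c) : x = 0 :=
  h x (x * c) (by rw [map_mul, hx, zero_mul]) (by rw [mul_comm (x * c) x, ← mul_assoc]; exact hc.symm)

/-- `AdicDefect ⟹ KernelIdempotent` (`x = i·x ∈ 𝔭²`). -/
theorem kernelIdempotent_of_adicDefect (h : AdicDefectI v) : KernelIdempotentI v := fun x hx => by
  obtain ⟨i, hi, hix⟩ := h x hx
  rw [← hix]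
  exact Ideal.mul_mem_mul ((RingHom.mem_ker).mpr hi) ((RingHom.mem_ker).mpr hx)

/-- **The adic cut on the interface**: `AdicDefect → AdicSeparated → S`. -/
theorem s_of_adic (hD : AdicDefectI v) (hS : AdicSeparatedI v) : SI v := fun x hx => by
  obtain ⟨i, hi, hix⟩ := hD x hx
  exact hS x i hi hix

/-- Auxiliary step `adicDefect_of_s`. [bookkeeping] -/
theorem adicDefect_of_s (h : SI v) : AdicDefectI v := fun x hx => ⟨0, map_zero v, by rw [h x hx, mul_zero]⟩

/-- Auxiliary step `adicSeparated_of_s`. [bookkeeping] -/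
theorem adicSeparated_of_s (h : SI v) : AdicSeparatedI v := fun x i hi hix =>
  h x (by rw [← hix, map_mul, hi, zero_mul])

/-- Auxiliary step `cancellation_of_s`. [bookkeeping] -/
theorem cancellation_of_s (h : SI v) : CancellationI v := fun g x hg hgx =>
  h x ((mul_eq_zero.mp (by rw [← map_mul, hgx, map_zero])).resolve_left hg)

/-- Auxiliary step `locTriv_of_s`. [bookkeeping] -/
theorem locTriv_of_s (h : SI v) : LocTrivI v := locTriv_of_adicDefect (adicDefect_of_s h)

/-- EXACTNESS on the interface: `S ⟺ AdicDefect ∧ AdicSeparated`. -/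
theorem s_iff_adic : SI v ↔ AdicDefectI v ∧ AdicSeparatedI v :=
  ⟨fun h => ⟨adicDefect_of_s h, adicSeparated_of_s h⟩, fun h => s_of_adic h.1 h.2⟩

/-- The top σ-member (census EQ11, for comparison): `S ⟺ LocTriv ∧ Cancellation`. -/
theorem s_iff_locTriv_cancellation : SI v ↔ LocTrivI v ∧ CancellationI v :=
  ⟨fun h => ⟨locTriv_of_s h, cancellation_of_s h⟩, fun h x hx => by
    obtain ⟨s, hs, hsx⟩ := h.1 x hx
    exact h.2 s x hs hsx⟩

/-- VALUE-ONE FORM of `AdicDefect`: every defect is killed by a class of value `1`. -/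
theorem adicDefect_iff_torsionOne : AdicDefectI v ↔ ∀ x : R, v x = 0 → ∃ m : R, v m = 1 ∧ m * x = 0 := by
  constructor
  · intro h x hx
    obtain ⟨i, hi, hix⟩ := h x hx
    exact ⟨1 - i, by rw [map_sub, map_one, hi, sub_zero], by rw [sub_mul, one_mul, hix, sub_self]⟩
  · intro h x hx
    obtain ⟨m, hm, hmx⟩ := h x hx
    exact ⟨1 - m, by rw [map_sub, map_one, hm, sub_self], by rw [sub_mul, one_mul, hmx, sub_zero]⟩

/-- VALUE-ONE FORM of `AdicSeparated`: classes of value `1` are non-zero-divisors. -/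
theorem adicSeparated_iff_cancelOne : AdicSeparatedI v ↔ ∀ m x : R, v m = 1 → m * x = 0 → x = 0 := by
  constructor
  · intro h m x hm hmx
    exact h x (1 - m) (by rw [map_sub, map_one, hm, sub_self]) (by rw [sub_mul, one_mul, hmx, sub_zero])
  · intro h x i hi hix
    exact h (1 - i) x (by rw [map_sub, map_one, hi, sub_zero]) (by rw [sub_mul, one_mul, hix, sub_self])

end Iface

/-! ## 2. The pieces on `P` (faithful to the interface by `Iff.rfl`) -/

/-- **`LocTriv`** — KZ up to a multiplier: every defect is killed by a class of non-zero value (`𝔭·P_𝔭 = 0`).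
Torsion half of the TOP member of the census σ-family EQ11 (= «DefectZeroDivisors»); WEAKER (`S ⟹`, `𝔛 ⊨ LocTriv ∧ ¬S`);
fed by 27508 `PiFlatDefect`, by 0541, by `AdicDefect`; feeds 32161 `DefectNegligible`. -/
def LocTriv : Prop := ∀ x : FormalPeriodRing, evalP x = 0 → ∃ s : FormalPeriodRing, evalP s ≠ 0 ∧ s * x = 0

/-- **`AdicDefect`** (NEW, left half of the adic cut) — every defect is fixed by a defect; equivalently killed by a
class of value one / of non-zero rational value / of non-zero algebraic value; equivalently dies `𝔭`-adically in some
finite stage.  WEAKER (`S ⟹`; `ℝ × ℝ ⊨ AdicDefect ∧ ¬S`); fed by `FlatDefect`; carries ALL the `π`-division content. -/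
def AdicDefect : Prop := ∀ x : FormalPeriodRing, evalP x = 0 → ∃ i : FormalPeriodRing, evalP i = 0 ∧ i * x = x

/-- **`AdicSeparated`** (NEW, right half of the adic cut) — `1 + 𝔭` acts injectively on `P`; equivalently classes of
value one / non-zero rational / non-zero algebraic value are non-zero-divisors; equivalently EVERY finite stage of `P`
is `𝔭`-adically separated (Krull).  WEAKER (`S ⟹`; `ℝ[X] ⊨ AdicSeparated ∧ ¬S`); the weakest cancellation half on
record: `⟸ Cancellation ⟸ ProperCone ∧ Reduced`, `⟸ KrullSeparated`, blind to `ϖ`-torsion phantoms (`𝔑`). -/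
def AdicSeparated : Prop := ∀ x i : FormalPeriodRing, evalP i = 0 → i * x = x → x = 0

/-- Comparison piece: SoloBlind's cancellation (C) read on `P` (census R1). -/
def Cancellation : Prop := ∀ g x : FormalPeriodRing, evalP g ≠ 0 → g * x = 0 → x = 0

/-- Comparison piece (lens-local since g3): absolute purity of the defect ideal. -/
def FlatDefect : Prop := ∀ x : FormalPeriodRing, evalP x = 0 → ∃ h : FormalPeriodRing, x = x * x * h

/-- Comparison piece (lens-local since g3): no idempotent of value `0` but `0`. -/
def Connected : Prop := ∀ e : FormalPeriodRing, IsIdempotentElem e → evalP e = 0 → e = 0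

/-- Comparison piece (g11/g12): `𝔭 ⊆ 𝔭²`. -/
def KernelIdempotent : Prop :=
  ∀ x : FormalPeriodRing, evalP x = 0 → x ∈ RingHom.ker evalP * RingHom.ker evalP

/-- Comparison piece (g12): `⋂ₙ 𝔭ⁿ = 0` in `P` itself. -/
def KrullSeparated : Prop := ∀ x : FormalPeriodRing, (∀ n : ℕ, x ∈ RingHom.ker evalP ^ n) → x = 0

/-- Comparison piece: 0541 (`KZ.PiLocalKernel`) read on `P`. -/
def PiPowerDefect : Prop := ∀ x : FormalPeriodRing, evalP x = 0 → ∃ N : ℕ, piClass ^ N * x = 0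

/-- Auxiliary step `locTriv_iff`. [bookkeeping] -/
theorem locTriv_iff : Iface.LocTrivI evalP ↔ LocTriv := Iff.rfl
/-- Auxiliary step `adicDefect_iff`. [bookkeeping] -/
theorem adicDefect_iff : Iface.AdicDefectI evalP ↔ AdicDefect := Iff.rfl
/-- Auxiliary step `adicSeparated_iff`. [bookkeeping] -/
theorem adicSeparated_iff : Iface.AdicSeparatedI evalP ↔ AdicSeparated := Iff.rfl
/-- Auxiliary step `cancellation_iff`. [bookkeeping] -/
theorem cancellation_iff : Iface.CancellationI evalP ↔ Cancellation := Iff.rfl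
/-- Auxiliary step `flatDefect_iff`. [bookkeeping] -/
theorem flatDefect_iff : Iface.FlatDefectI evalP ↔ FlatDefect := Iff.rfl
/-- Auxiliary step `connected_iff`. [bookkeeping] -/
theorem connected_iff : Iface.ConnectedI evalP ↔ Connected := Iff.rfl
/-- Auxiliary step `kernelIdempotent_iff`. [bookkeeping] -/
theorem kernelIdempotent_iff : Iface.KernelIdempotentI evalP ↔ KernelIdempotent := Iff.rfl
/-- Auxiliary step `krullSeparated_iff`. [bookkeeping] -/
theorem krullSeparated_iff : Iface.KrullSeparatedI evalP ↔ KrullSeparated := Iff.rfl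
/-- Auxiliary step `piPowerDefect_iff`. [bookkeeping] -/
theorem piPowerDefect_iff : Iface.PiPowerDefectI evalP piClass ↔ PiPowerDefect := Iff.rfl
/-- Auxiliary step `piFlatDefect_iff`. [bookkeeping] -/
theorem piFlatDefect_iff : Iface.PiFlatDefectI evalP piClass ↔ RootDecompPureDefect.PiFlatDefect := Iff.rfl
/-- Auxiliary step `piConnected_iff`. [bookkeeping] -/
theorem piConnected_iff : Iface.PiConnectedI evalP piClass ↔ RootDecompPureDefect.PiConnected := Iff.rfl
/-- Auxiliary step `summit_iff_SI`. [bookkeeping] -/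
theorem summit_iff_SI : _root_.KontsevichZagierPeriods ↔ Iface.SI evalP := summit_iff_kernel

/-! ## 3. The adic cut on `P`: deciding theorem, necessity, exactness -/

/-- **DECIDING THEOREM of node g13 — `AdicDefect → AdicSeparated → KontsevichZagierPeriods`**
(a defect `x` is fixed by a defect `i`; `1 + 𝔭` regular gives `x = 0`; frame `summit_iff_kernel`). -/
theorem closes_adic (hD : AdicDefect) (hS : AdicSeparated) : _root_.KontsevichZagierPeriods :=
  summit_iff_SI.mpr (Iface.s_of_adic hD hS)

/-- Auxiliary step `adicDefect_of_summit`. [bookkeeping] -/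
theorem adicDefect_of_summit (h : _root_.KontsevichZagierPeriods) : AdicDefect :=
  Iface.adicDefect_of_s (summit_iff_SI.mp h)

/-- Auxiliary step `adicSeparated_of_summit`. [bookkeeping] -/
theorem adicSeparated_of_summit (h : _root_.KontsevichZagierPeriods) : AdicSeparated :=
  Iface.adicSeparated_of_s (summit_iff_SI.mp h)

/-- Auxiliary step `locTriv_of_summit`. [bookkeeping] -/
theorem locTriv_of_summit (h : _root_.KontsevichZagierPeriods) : LocTriv := Iface.locTriv_of_s (summit_iff_SI.mp h)

/-- Auxiliary step `cancellation_of_summit`. [bookkeeping] -/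
theorem cancellation_of_summit (h : _root_.KontsevichZagierPeriods) : Cancellation :=
  Iface.cancellation_of_s (summit_iff_SI.mp h)

/-- **EXACTNESS — `S ⟺ AdicDefect ∧ AdicSeparated`** (the σ-member at `M = 1 + 𝔭`). -/
theorem summit_iff_adic : _root_.KontsevichZagierPeriods ↔ AdicDefect ∧ AdicSeparated :=
  summit_iff_SI.trans Iface.s_iff_adic

/-- The top σ-member for comparison (census EQ11/R1, not claimed): `S ⟺ LocTriv ∧ Cancellation`. -/
theorem summit_iff_locTriv_cancellation : _root_.KontsevichZagierPeriods ↔ LocTriv ∧ Cancellation :=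
  summit_iff_SI.trans Iface.s_iff_locTriv_cancellation

/-! ## 4. Value forms: one / rational / algebraic -/

/-- Auxiliary step `adicDefect_iff_torsionOne`. [bookkeeping] -/
theorem adicDefect_iff_torsionOne :
    AdicDefect ↔ ∀ x : FormalPeriodRing, evalP x = 0 → ∃ m : FormalPeriodRing, evalP m = 1 ∧ m * x = 0 :=
  Iface.adicDefect_iff_torsionOne

/-- Auxiliary step `adicSeparated_iff_cancelOne`. [bookkeeping] -/
theorem adicSeparated_iff_cancelOne :
    AdicSeparated ↔ ∀ m x : FormalPeriodRing, evalP m = 1 → m * x = 0 → x = 0 :=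
  Iface.adicSeparated_iff_cancelOne

/-- A non-zero integer is a unit of `P` (point classes; tree lemma `natCast_succ_isUnit`). -/
theorem isUnit_intCast {N : ℤ} (hN : N ≠ 0) : IsUnit (N : FormalPeriodRing) := by
  obtain ⟨k, hk⟩ := Nat.exists_eq_succ_of_ne_zero (Int.natAbs_ne_zero.mpr hN)
  have hu : IsUnit ((N.natAbs : ℤ) : FormalPeriodRing) := by
    rw [Int.cast_natCast, hk, Nat.cast_succ]; exact natCast_succ_isUnit k
  rcases Int.natAbs_eq N with h | h
  · rw [h]; exact hu
  · rw [h, Int.cast_neg]; exact hu.neg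

/-- If `N·x = j·x` with `N` a non-zero integer and `v j = 0`, then `x` is fixed by a defect. -/
theorem exists_fix_of_intCast_mul_eq {x j : FormalPeriodRing} {N : ℤ} (hN : N ≠ 0) (hj : evalP j = 0)
    (h : (N : FormalPeriodRing) * x = j * x) : ∃ i : FormalPeriodRing, evalP i = 0 ∧ i * x = x := by
  obtain ⟨u, hu⟩ := isUnit_intCast hN
  refine ⟨↑u⁻¹ * j, by rw [map_mul, hj, mul_zero], ?_⟩
  rw [mul_assoc, ← h, ← hu, ← mul_assoc, Units.inv_mul, one_mul]

/-- RATIONAL FORM of `AdicDefect`: every defect is killed by a class of non-zero RATIONAL value. -/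
theorem adicDefect_iff_ratTorsion :
    AdicDefect ↔ ∀ x : FormalPeriodRing, evalP x = 0 →
      ∃ (m : FormalPeriodRing) (q : ℚ), q ≠ 0 ∧ evalP m = q ∧ m * x = 0 := by
  constructor
  · intro h x hx
    obtain ⟨m, hm, hmx⟩ := adicDefect_iff_torsionOne.mp h x hx
    exact ⟨m, 1, one_ne_zero, by rw [hm, Rat.cast_one], hmx⟩
  · intro h x hx
    obtain ⟨m, q, hq, hm, hmx⟩ := h x hx
    -- `d·m` has integer value `q.num`; `(q.num − d·m)·x = q.num·x` with `v (q.num − d·m) = 0`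
    have hnum : q.num ≠ 0 := Rat.num_ne_zero.mpr hq
    have hval : evalP ((q.den : FormalPeriodRing) * m) = (q.num : ℝ) := by
      rw [map_mul, map_natCast, hm]; exact_mod_cast Rat.den_mul_eq_num q
    refine exists_fix_of_intCast_mul_eq hnum (j := (q.num : FormalPeriodRing) - (q.den : FormalPeriodRing) * m)
      (by rw [map_sub, hval, map_intCast, sub_self]) ?_
    rw [sub_mul, mul_assoc, hmx, mul_zero, sub_zero]

end Summit.KontsevichZagierPeriods.RootDecompAdicStages
end
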